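import Literature.Probability.Percolation.ArmSeparationExtSlotEvents
import Literature.Probability.Percolation.ArmSeparationExtSlotArith
import Literature.Probability.Percolation.ArmSeparationExtSectors
import HarnessLib

/-!
# Outer slots: validity, numeric facts and windows

Topic: Probability / Percolation; family `crit-perc`. A brick of the discharge of
`Literature.Probability.Percolation.Nolin2008_twoArm_separation` (Nolin 2008, Thm. 11
[arXiv 0711.4948: Thm. 10]; `ArmSeparation.lean`), landing of the EXTERNAL extremities (mirror of
`ArmSeparationSlotSep.lean`). The standing size conditions of a rung of the outer landing step
(`EParams.Valid`), the subtraction-free integer facts used by all later `omega`/`linarith` calls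
(`EParams.Valid.efacts`, `ESlot.eifacts`; `omega` is always run on a small context), the
side conditions of a slot holding both arms (`ESlot.AdmissibleE`, `ESlot.SepOKE`, derived from
`GoodTip` and `row_gap_of_lt`), the alignment of the spoke rows (`EParams.adj_spec`), and the
facts about the two windows (`ESlot.windowB_factsE`, `ESlot.windowW_factsE`) and the two entry
pieces (`ESlot.gEo_factsE`, `ESlot.gEc_factsE`).

## References

* P. Nolin, *Near-critical percolation in two dimensions*, Electron. J. Probab. 13 (2008), §4.3
  Prop. 12, Lemma 13, §4.4 [arXiv 0711.4948: Prop. 11, Lemma 12, Thm. 10]. [Nolin2008]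
-/

noncomputable section

open Set

namespace Literature.Probability.Percolation

open LatticeModels Tube

/-! ### Valid rungs -/

namespace EParams

/-- **Standing size conditions of a rung of the outer landing step**: a large smallest scale
`k₀ ≥ 64`, at least one scale, the depth unit small (`64 μ ≤ M`), the tip margin between `8μ`
and `M/4`, the inner radius `n ≤ M`, the target radius `4M ≤ N ≤ 5M`. [cite: Nolin2008, §4.4 (arXiv 0711.4948: Thm. 10, external extremities)] -/
structure Valid (P : EParams) : Prop where
  /-- smallest scale -/
  hk₀ : 64 ≤ P.k₀
  /-- at least one scale -/
  hK : 1 ≤ P.K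
  /-- depth unit -/
  hM : 64 * P.μ ≤ P.M
  /-- tip margin, below -/
  hR₀ : 8 * P.μ ≤ P.R₀
  /-- tip margin, above -/
  hR₀M : 4 * P.R₀ ≤ P.M
  /-- inner radius -/
  hn : P.n ≤ P.M
  /-- target radius, below -/
  hN : 4 * P.M ≤ P.N
  /-- target radius, above -/
  hN' : P.N ≤ 5 * P.M

variable {P : EParams}

/-- Every fence scale is at most `μ / 32`. [folklore] -/
theorem scale_le (P : EParams) {j : ℕ} (hj : j < P.K) : 32 * trapScale P.k₀ j ≤ P.μ := by
  unfold EParams.μ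
  calc 32 * trapScale P.k₀ j = trapScale P.k₀ (j + 1) := (trapScale_succ _ _).symm
    _ ≤ trapScale P.k₀ P.K := trapScale_mono _ hj

/-- With at least one scale, `32 k₀ ≤ μ`. [folklore] -/
theorem mu_ge (hK : 1 ≤ P.K) : 32 * P.k₀ ≤ P.μ := by
  unfold EParams.μ trapScale
  calc 32 * P.k₀ = P.k₀ * 32 ^ 1 := by ring
    _ ≤ P.k₀ * 32 ^ P.K := Nat.mul_le_mul_left _ (Nat.pow_le_pow_right (by norm_num) hK)

/-- The ring radii: `rB = s (q + 1)` with `s q ≤ 2M + μ < s q + s`, and similarly for `rW`. [folklore] -/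
theorem ring_facts (hk : 1 ≤ P.k₀) :
    2 * P.M + P.μ < P.rB ∧ P.rB ≤ 2 * P.M + P.μ + P.s ∧ 2 * P.M + 3 * P.μ < P.rW ∧ P.rW ≤ 2 * P.M + 3 * P.μ + P.s ∧
      P.nB * P.s = P.rB ∧ P.nW * P.s = P.rW := by
  have hs : P.s = P.k₀ := rfl
  have h1 := Nat.div_mul_le_self (2 * P.M + P.μ) P.s
  have h2 := Nat.lt_div_mul_add (a := 2 * P.M + P.μ) (b := P.s) (by rw [hs]; exact hk)
  have h3 := Nat.div_mul_le_self (2 * P.M + 3 * P.μ) P.s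
  have h4 := Nat.lt_div_mul_add (a := 2 * P.M + 3 * P.μ) (b := P.s) (by rw [hs]; exact hk)
  have eB : P.rB = (2 * P.M + P.μ) / P.s * P.s + P.s := by unfold EParams.rB; ring
  have eW : P.rW = (2 * P.M + 3 * P.μ) / P.s * P.s + P.s := by unfold EParams.rW; ring
  refine ⟨by omega, by omega, by omega, by omega, ?_, ?_⟩
  · unfold EParams.nB EParams.rB; rw [Nat.mul_div_cancel_left _ (by rw [hs]; exact hk), mul_comm]
  · unfold EParams.nW EParams.rW; rw [Nat.mul_div_cancel_left _ (by rw [hs]; exact hk), mul_comm]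

/-- **The integer facts of a valid rung**, subtraction-free. [folklore] -/
theorem Valid.efacts (hV : P.Valid) :
    ((P.s : ℤ) = P.k₀ ∧ 64 ≤ (P.k₀ : ℤ) ∧ 32 * (P.k₀ : ℤ) ≤ P.μ ∧ 4 * (P.w : ℤ) ≤ P.k₀ ∧ (P.k₀ : ℤ) ≤ 4 * P.w + 3 ∧
      4 * (P.e : ℤ) ≤ P.k₀ ∧ (P.k₀ : ℤ) ≤ 4 * P.e + 3 ∧ 16 * (P.ε : ℤ) ≤ P.k₀ ∧ (P.k₀ : ℤ) ≤ 16 * P.ε + 15) ∧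
    (2 * (P.M : ℤ) + P.μ < P.rB ∧ (P.rB : ℤ) ≤ 2 * P.M + P.μ + P.s ∧ 2 * (P.M : ℤ) + 3 * P.μ < P.rW ∧
      (P.rW : ℤ) ≤ 2 * P.M + 3 * P.μ + P.s ∧ P.nB * P.s = P.rB ∧ P.nW * P.s = P.rW) ∧
    ((P.LB : ℤ) + 2 * P.M = P.rB + P.e + P.s ∧ (P.LW : ℤ) + 2 * P.M = P.rW + P.e + P.s ∧
      (P.WB : ℤ) + P.rB = P.N + P.e ∧ (P.WW : ℤ) + P.rW = P.N + P.e) ∧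
    (64 * (P.μ : ℤ) ≤ P.M ∧ 8 * (P.μ : ℤ) ≤ P.R₀ ∧ 4 * (P.R₀ : ℤ) ≤ P.M ∧ (P.n : ℤ) ≤ P.M ∧ 4 * (P.M : ℤ) ≤ P.N ∧
      (P.N : ℤ) ≤ 5 * P.M) := by
  have hk : 1 ≤ P.k₀ := le_trans (by norm_num) hV.hk₀
  obtain ⟨r1, r2, r3, r4, r5, r6⟩ := ring_facts hk
  have hμ := mu_ge hV.hK
  have hw : P.w = P.k₀ / 4 := rfl
  have he : P.e = P.k₀ / 4 := rfl
  have hε : P.ε = P.k₀ / 16 := rfl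
  have hs : P.s = P.k₀ := rfl
  have hk₀ := hV.hk₀
  refine ⟨⟨by rw [hs], by exact_mod_cast hk₀, by exact_mod_cast hμ, ?_, ?_, ?_, ?_, ?_, ?_⟩,
    ⟨by exact_mod_cast r1, by exact_mod_cast r2, by exact_mod_cast r3, by exact_mod_cast r4, r5, r6⟩, ⟨?_, ?_, ?_, ?_⟩,
    ⟨by exact_mod_cast hV.hM, by exact_mod_cast hV.hR₀, by exact_mod_cast hV.hR₀M, by exact_mod_cast hV.hn, by exact_mod_cast hV.hN,
      by exact_mod_cast hV.hN'⟩⟩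
  · rw [hw]; clear * -; omega
  · rw [hw]; clear * -; omega
  · rw [he]; clear * -; omega
  · rw [he]; clear * -; omega
  · rw [hε]; clear * -; omega
  · rw [hε]; clear * -; omega
  · have : 2 * P.M ≤ P.rB + P.e + P.s := by clear * - r1; omega
    unfold EParams.LB; clear * - this; omega
  · have : 2 * P.M ≤ P.rW + P.e + P.s := by clear * - r3; omega
    unfold EParams.LW; clear * - this; omega
  · have h1 := hV.hN; have h2 := hV.hM
    have : P.rB ≤ P.N + P.e := by clear * - r2 h1 h2 hs hμ; omega
    unfold EParams.WB; clear * - this; omega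
  · have h1 := hV.hN; have h2 := hV.hM
    have : P.rW ≤ P.N + P.e := by clear * - r4 h1 h2 hs hμ; omega
    unfold EParams.WW; clear * - this; omega

/-! ### Alignment of the spoke rows -/

/-- Shifting the ring radius by a multiple of the chunk shifts the lateral index. [folklore] -/
theorem _root_.Literature.Probability.Percolation.latIdx_add_mul {s r d : ℕ} {ξ : ℤ} (hξ : -(r : ℤ) ≤ ξ) (hs : 1 ≤ s) :
    latIdx s (r + d * s) ξ = latIdx s r ξ + d := by
  unfold latIdx
  have h1 : (ξ + ((r + d * s : ℕ) : ℤ)).toNat = (ξ + r).toNat + d * s := by push_cast; omega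
  rw [h1, Nat.add_mul_div_right _ _ (by omega)]

/-- **The spoke rows are aligned**: the rows `[ξ, ξ + 2ε]` of the spoke placed at
`ξ = ξ₀ + adj ξ₀` lie inside one lateral chunk of the ring `B` (`4 · 2ε ≤ s`... precisely `4ε ≤ s`,
`-rB ≤ ξ₀`). [folklore] -/
theorem adj_spec {ξ₀ : ℤ} (hξ₀ : -(P.rB : ℤ) ≤ ξ₀) (hs : 1 ≤ P.s) (hε : 4 * P.ε ≤ P.s) :
    -(P.rB : ℤ) + latIdx P.s P.rB (ξ₀ + P.adj ξ₀) * P.s ≤ ξ₀ + P.adj ξ₀ ∧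
      ξ₀ + P.adj ξ₀ + 2 * P.ε ≤ -(P.rB : ℤ) + (latIdx P.s P.rB (ξ₀ + P.adj ξ₀) + 1) * P.s ∧ P.adj ξ₀ ≤ 2 * P.ε := by
  obtain ⟨x, hx⟩ : ∃ x : ℕ, x = (ξ₀ + P.rB).toNat := ⟨_, rfl⟩
  have hx0 : (x : ℤ) = ξ₀ + P.rB := by rw [hx]; omega
  have hdm : P.s * (x / P.s) + x % P.s = x := Nat.div_add_mod x P.s
  have hml : x % P.s < P.s := Nat.mod_lt x hs
  have hdm' : (P.s : ℤ) * ((x / P.s : ℕ) : ℤ) + ((x % P.s : ℕ) : ℤ) = x := by exact_mod_cast hdm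
  have hml' : ((x % P.s : ℕ) : ℤ) < P.s := by exact_mod_cast hml
  have hε' : 4 * (P.ε : ℤ) ≤ P.s := by exact_mod_cast hε
  have hadj : P.adj ξ₀ = if x % P.s + 2 * P.ε ≤ P.s then 0 else 2 * P.ε := by unfold EParams.adj; rw [← hx]
  by_cases hc : x % P.s + 2 * P.ε ≤ P.s
  · rw [hadj, if_pos hc]
    have hc' : ((x % P.s : ℕ) : ℤ) + 2 * P.ε ≤ P.s := by exact_mod_cast hc
    have hq : latIdx P.s P.rB (ξ₀ + ((0 : ℕ) : ℤ)) = x / P.s := by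
      unfold latIdx; rw [Nat.cast_zero, add_zero, ← hx]
    rw [hq]
    simp only [Nat.cast_zero, add_zero]
    refine ⟨by linarith, by push_cast; linarith, Nat.zero_le _⟩
  · rw [hadj, if_neg hc]
    have hc' : (P.s : ℤ) < ((x % P.s : ℕ) : ℤ) + 2 * P.ε := by
      have : P.s < x % P.s + 2 * P.ε := not_le.1 hc
      exact_mod_cast this
    have hq : latIdx P.s P.rB (ξ₀ + ((2 * P.ε : ℕ) : ℤ)) = x / P.s + 1 := by
      unfold latIdx
      have h1 : (ξ₀ + ((2 * P.ε : ℕ) : ℤ) + P.rB).toNat = x + 2 * P.ε := by rw [hx]; push_cast; omega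
      rw [h1]
      apply Nat.div_eq_of_lt_le
      · have : (((x / P.s + 1) * P.s : ℕ) : ℤ) ≤ ((x + 2 * P.ε : ℕ) : ℤ) := by push_cast; nlinarith
        exact_mod_cast this
      · have : ((x + 2 * P.ε : ℕ) : ℤ) < (((x / P.s + 1 + 1) * P.s : ℕ) : ℤ) := by push_cast; nlinarith
        exact_mod_cast this
    rw [hq]
    refine ⟨by push_cast; nlinarith, by push_cast; nlinarith, le_rfl⟩

end EParams

/-! ### Slots in range, admissible, separated -/

namespace ESlot

variable (P : EParams) (σ : ESlot)

/-- The slot's indices are in range. [folklore] -/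
structure InRange : Prop where
  /-- side of the open tip -/
  hio : σ.io < 6
  /-- scale index of the open tip -/
  hjo : σ.jo < P.K
  /-- side of the closed tip -/
  hic : σ.ic < 6
  /-- scale index of the closed tip -/
  hjc : σ.jc < P.K

/-- **Admissible slot**: both windows can hold a tip row `t` with `-2M + R₀ ≤ t ≤ -R₀`. [folklore] -/
def AdmissibleE (P' : EParams) (σ' : ESlot) : Prop :=
  σ'.To P' ≤ -(P'.R₀ : ℤ) ∧ -(2 * (P'.M : ℤ)) + P'.R₀ < σ'.To P' + P'.w ∧
    σ'.Tc P' ≤ -(P'.R₀ : ℤ) ∧ -(2 * (P'.M : ℤ)) + P'.R₀ < σ'.Tc P' + P'.w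

/-- **Separated slot**: tips on a common side have windows as far apart as the row gap of two
fenced tips of different colours (`row_gap_of_lt`). [folklore] -/
def SepOKE (P' : EParams) (σ' : ESlot) : Prop :=
  σ'.io ≠ σ'.ic ∨ σ'.To P' + 8 * σ'.ko P' < σ'.Tc P' + P'.w ∨ σ'.Tc P' + 8 * σ'.kc P' < σ'.To P' + P'.w

variable {P σ}

/-- A slot holding both arms is admissible. [folklore] -/
theorem admissibleE_of_mem {ω : SiteConfig (Site 2)} (hω : ω ∈ σ.blackArm P ∩ σ.whiteArm P) : σ.AdmissibleE P := by
  obtain ⟨⟨Fo, -, h1, h2, hgo⟩, ⟨Fc, -, h3, h4, hgc⟩⟩ := hω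
  unfold GoodTip at hgo hgc
  exact ⟨by omega, by omega, by omega, by omega⟩

/-- **A slot holding both arms is separated** (`n ≤ M`, `1 ≤ k₀`, `128 k_j < M`): two fenced tips
of different colours on a common side are more than `8k` rows apart (`row_gap_of_lt`). [cite: Nolin2008, §4.4 Lemma 15 (proof) (arXiv 0711.4948: Lemma 14)] -/
theorem sepOKE_of_mem (hnM : P.n ≤ P.M) (hk₀ : 1 ≤ P.k₀) (hKM : ∀ j < P.K, 128 * (trapScale P.k₀ j : ℤ) < P.M)
    {ω : SiteConfig (Site 2)} (hω : ω ∈ σ.blackArm P ∩ σ.whiteArm P) : σ.SepOKE P := by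
  obtain ⟨⟨Fo, hjo, h1, h2, -⟩, ⟨Fc, hjc, h3, h4, -⟩⟩ := hω
  by_cases hii : σ.io = σ.ic
  · right
    have hko : Fo.k = σ.ko P := by show trapScale P.k₀ Fo.j = trapScale P.k₀ σ.jo; rw [hjo]
    have hkc : Fc.k = σ.kc P := by show trapScale P.k₀ Fc.j = trapScale P.k₀ σ.jc; rw [hjc]
    -- read the closed arm in the frame of the open one
    have hcfg : (rotConfig σ.ic ω)ᶜ = (rotConfig σ.io ω)ᶜ := by rw [hii]
    set Fc' := Fc.cast hcfg with hFc'
    have hz' : Fc'.z = Fc.z := (Fc.cast_data hcfg).1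
    have hk' : Fc'.k = Fc.k := by show trapScale P.k₀ Fc'.j = trapScale P.k₀ Fc.j; rw [(Fc.cast_data hcfg).2.1]
    have hne : Fo.z 1 ≠ Fc'.z 1 := fun h => by
      have := eq_of_mem_trapO Fo.z_mem Fc'.z_mem h
      exact Fc'.z_mem_config (this ▸ Fo.z_mem_config)
    rcases lt_or_gt_of_ne hne with hlt | hlt
    · have := row_gap_of_lt hnM hk₀ hKM (fun v hv hv' => (Set.mem_compl_iff _ _).1 hv hv') Fo Fc' hlt
      rw [hz', hko] at this; left; omega
    · have := row_gap_of_lt hnM hk₀ hKM (fun v hv hv' => (Set.mem_compl_iff _ _).1 hv' hv) Fc' Fo hlt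
      rw [hz', hk', hkc] at this; right; omega
  · exact Or.inl hii

/-- **The integer facts of a valid rung and a slot in range, admissible** — subtraction-free. [folklore] -/
theorem eifacts (hV : P.Valid) (hσ : σ.InRange P) (hadm : σ.AdmissibleE P) :
    ((P.s : ℤ) = P.k₀ ∧ 64 ≤ (P.k₀ : ℤ) ∧ 32 * (P.k₀ : ℤ) ≤ P.μ ∧ 4 * (P.w : ℤ) ≤ P.k₀ ∧ (P.k₀ : ℤ) ≤ 4 * P.w + 3 ∧
      4 * (P.e : ℤ) ≤ P.k₀ ∧ (P.k₀ : ℤ) ≤ 4 * P.e + 3 ∧ 16 * (P.ε : ℤ) ≤ P.k₀ ∧ (P.k₀ : ℤ) ≤ 16 * P.ε + 15) ∧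
    (2 * (P.M : ℤ) + P.μ < P.rB ∧ (P.rB : ℤ) ≤ 2 * P.M + P.μ + P.s ∧ 2 * (P.M : ℤ) + 3 * P.μ < P.rW ∧
      (P.rW : ℤ) ≤ 2 * P.M + 3 * P.μ + P.s ∧ P.nB * P.s = P.rB ∧ P.nW * P.s = P.rW) ∧
    ((P.LB : ℤ) + 2 * P.M = P.rB + P.e + P.s ∧ (P.LW : ℤ) + 2 * P.M = P.rW + P.e + P.s ∧
      (P.WB : ℤ) + P.rB = P.N + P.e ∧ (P.WW : ℤ) + P.rW = P.N + P.e) ∧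
    (64 * (P.μ : ℤ) ≤ P.M ∧ 8 * (P.μ : ℤ) ≤ P.R₀ ∧ 4 * (P.R₀ : ℤ) ≤ P.M ∧ (P.n : ℤ) ≤ P.M ∧ 4 * (P.M : ℤ) ≤ P.N ∧
      (P.N : ℤ) ≤ 5 * P.M) ∧
    ((P.k₀ : ℤ) ≤ σ.ko P ∧ 32 * (σ.ko P : ℤ) ≤ P.μ ∧ (P.k₀ : ℤ) ≤ σ.kc P ∧ 32 * (σ.kc P : ℤ) ≤ P.μ ∧
      (P.w : ℤ) ≤ σ.wo P ∧ (σ.wo P : ℤ) ≤ P.w + 2 * P.ε ∧ (P.w : ℤ) ≤ σ.wc P ∧ (σ.wc P : ℤ) ≤ P.w + 2 * P.ε ∧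
      σ.ξo P = σ.To P + σ.wo P + σ.ko P + (σ.ko P / 4 : ℕ) ∧ σ.ξc P = σ.Tc P + σ.wc P + σ.kc P + (σ.kc P / 4 : ℕ)) ∧
    (σ.To P ≤ -(P.R₀ : ℤ) ∧ -(2 * (P.M : ℤ)) + P.R₀ < σ.To P + P.w ∧ σ.Tc P ≤ -(P.R₀ : ℤ) ∧
      -(2 * (P.M : ℤ)) + P.R₀ < σ.Tc P + P.w ∧
      -(P.rB : ℤ) + (P.rB / 4 : ℕ) ≤ σ.tgo P ∧ σ.tgo P ≤ -((P.rB / 4 : ℕ) : ℤ) ∧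
      -(P.rW : ℤ) + (P.rW / 4 : ℕ) ≤ σ.tgc P ∧ σ.tgc P ≤ -((P.rW / 4 : ℕ) : ℤ)) ∧
    (-(P.rB : ℤ) + σ.ιo P * P.s ≤ σ.ξo P ∧ σ.ξo P + 2 * P.ε ≤ -(P.rB : ℤ) + (σ.ιo P + 1) * P.s ∧
      -(P.rB : ℤ) + σ.ιc P * P.s ≤ σ.ξc P ∧ σ.ξc P + 2 * P.ε ≤ -(P.rB : ℤ) + (σ.ιc P + 1) * P.s ∧
      -(P.rW : ℤ) + σ.ιw P * P.s ≤ σ.ξc P ∧ σ.ξc P + 2 * P.ε ≤ -(P.rW : ℤ) + (σ.ιw P + 1) * P.s) := by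
  obtain ⟨A, B, C, D⟩ := hV.efacts
  obtain ⟨hs, hk₀, hμ, hw1, hw2, he1, he2, hε1, hε2⟩ := A
  obtain ⟨hrB1, hrB2, hrW1, hrW2, hnB, hnW⟩ := B
  obtain ⟨ha1, ha2, ha3, ha4⟩ := hadm
  have hko1 : P.k₀ ≤ σ.ko P := le_trapScale _ _
  have hko2 : 32 * σ.ko P ≤ P.μ := P.scale_le hσ.hjo
  have hkc1 : P.k₀ ≤ σ.kc P := le_trapScale _ _
  have hkc2 : 32 * σ.kc P ≤ P.μ := P.scale_le hσ.hjc
  have htgo := tgtRow_mem (n := P.rB) (σ.bo P)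
  have htgc := tgtRow_mem (n := P.rW) (σ.bc P)
  have hs1 : 1 ≤ P.s := by clear * - hs hk₀; omega
  have hε4 : 4 * P.ε ≤ P.s := by clear * - hs hε1; omega
  -- alignment of the two spokes (on `B`), and of the white spoke on `W`
  have hξ₀o : -(P.rB : ℤ) ≤ σ.To P + P.w + σ.ko P + (σ.ko P / 4 : ℕ) := by clear * - ha2 hrB1 D; omega
  have hξ₀c : -(P.rB : ℤ) ≤ σ.Tc P + P.w + σ.kc P + (σ.kc P / 4 : ℕ) := by clear * - ha4 hrB1 D; omega
  obtain ⟨o1, o2, o3⟩ := P.adj_spec hξ₀o hs1 hε4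
  obtain ⟨c1, c2, c3⟩ := P.adj_spec hξ₀c hs1 hε4
  have hwo : σ.wo P = P.w + P.adj (σ.To P + P.w + σ.ko P + (σ.ko P / 4 : ℕ)) := rfl
  have hwc : σ.wc P = P.w + P.adj (σ.Tc P + P.w + σ.kc P + (σ.kc P / 4 : ℕ)) := rfl
  have hξo : σ.ξo P = σ.To P + σ.wo P + σ.ko P + (σ.ko P / 4 : ℕ) := rfl
  have hξc : σ.ξc P = σ.Tc P + σ.wc P + σ.kc P + (σ.kc P / 4 : ℕ) := rfl
  have eo : σ.ξo P = σ.To P + P.w + σ.ko P + (σ.ko P / 4 : ℕ) + P.adj (σ.To P + P.w + σ.ko P + (σ.ko P / 4 : ℕ)) := by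
    rw [hξo, hwo]; push_cast; ring
  have ec : σ.ξc P = σ.Tc P + P.w + σ.kc P + (σ.kc P / 4 : ℕ) + P.adj (σ.Tc P + P.w + σ.kc P + (σ.kc P / 4 : ℕ)) := by
    rw [hξc, hwc]; push_cast; ring
  have hιo : σ.ιo P = latIdx P.s P.rB (σ.ξo P) := rfl
  have hιc : σ.ιc P = latIdx P.s P.rB (σ.ξc P) := rfl
  -- the white spoke on the ring `W`: shift the index
  have hd : P.rW = P.rB + (P.nW - P.nB) * P.s := by
    have h1 : P.nB * P.s ≤ P.nW * P.s := by rw [hnB, hnW]; clear * - hrB2 hrW1 hμ hs; omega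
    rw [← hnB, ← hnW, Nat.sub_mul]; clear * - h1; omega
  have hιw : σ.ιw P = σ.ιc P + (P.nW - P.nB) := by
    show latIdx P.s P.rW (σ.ξc P) = latIdx P.s P.rB (σ.ξc P) + (P.nW - P.nB)
    rw [hd]; exact latIdx_add_mul (by rw [ec]; clear * - hξ₀c c3; omega) hs1
  have hdW : (P.rW : ℤ) = P.rB + ((P.nW - P.nB : ℕ) : ℤ) * P.s := by exact_mod_cast hd
  refine ⟨⟨hs, hk₀, hμ, hw1, hw2, he1, he2, hε1, hε2⟩, ⟨hrB1, hrB2, hrW1, hrW2, hnB, hnW⟩, C, D,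
    ⟨by exact_mod_cast hko1, by exact_mod_cast hko2, by exact_mod_cast hkc1, by exact_mod_cast hkc2, ?_, ?_, ?_, ?_, hξo, hξc⟩,
    ⟨ha1, ha2, ha3, ha4, htgo.1, htgo.2, htgc.1, htgc.2⟩, ⟨?_, ?_, ?_, ?_, ?_, ?_⟩⟩
  · rw [hwo]; push_cast; linarith
  · rw [hwo]; push_cast; have : (P.adj (σ.To P + P.w + σ.ko P + (σ.ko P / 4 : ℕ)) : ℤ) ≤ 2 * P.ε := by exact_mod_cast o3
    linarith
  · rw [hwc]; push_cast; linarith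
  · rw [hwc]; push_cast; have : (P.adj (σ.Tc P + P.w + σ.kc P + (σ.kc P / 4 : ℕ)) : ℤ) ≤ 2 * P.ε := by exact_mod_cast c3
    linarith
  · rw [hιo, eo]; exact o1
  · rw [hιo, eo]; exact o2
  · rw [hιc, ec]; exact c1
  · rw [hιc, ec]; exact c2
  · rw [hιw, hιc, hdW, Nat.cast_add]; have := c1; rw [← ec] at this; linarith [this]
  · rw [hιw, hιc, hdW, Nat.cast_add]; have := c2; rw [← ec] at this; linarith [this]

/-! ### The windows -/

/-- Block bookkeeping for an eight-tube window: `blockOff n i + 2ι + 3 < blockEnd n i ≤ 12n - 4`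
(`i < 6`, `ι + 3 ≤ n`). [folklore] -/
theorem _root_.Literature.Probability.Percolation.ewindow_pos_bounds {n i ι : ℕ} (hi : i < 6) (hι : ι + 3 ≤ n) :
    blockOff n i + 2 * ι + 3 < blockEnd n i ∧ blockEnd n i ≤ 12 * n - 4 := by
  interval_cases i <;> simp only [blockOff, blockEnd] <;> omega

/-- **The window of ring `B`** (positions `loB, …, hiB = loB + 7` on the side `ic`): the lateral
index of the white spoke is `≥ 2` and `≤ nB - 4`, the window sits inside the block of the side
`ic`. [folklore] -/
theorem windowB_factsE (hV : P.Valid) (hσ : σ.InRange P) (hadm : σ.AdmissibleE P) :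
    2 ≤ σ.ιc P ∧ σ.ιc P + 4 ≤ P.nB ∧ 1 ≤ P.nB ∧ blockOff P.nB σ.ic ≤ σ.loB P ∧ σ.hiB P = σ.loB P + 7 ∧
      σ.hiB P < blockEnd P.nB σ.ic ∧ σ.hiB P < 12 * P.nB - 4 := by
  obtain ⟨⟨hs, hk₀, hμ, hw1, hw2, he1, he2, hε1, hε2⟩, ⟨hrB1, hrB2, hrW1, hrW2, hnB, hnW⟩, -, ⟨hM, hR₀, hR₀M, hn, hN, hN'⟩,
    ⟨hko1, hko2, hkc1, hkc2, hwo1, hwo2, hwc1, hwc2, hξo, hξc⟩, ⟨ha1, ha2, ha3, ha4, -, -, -, -⟩, ⟨-, -, hι1, hι2, -, -⟩⟩ :=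
    eifacts hV hσ hadm
  have hnB' : ((P.nB : ℕ) : ℤ) * P.s = P.rB := by exact_mod_cast hnB
  have hs0 : 0 < P.s := by clear * - hs hk₀; omega
  have hko4 : ((σ.ko P / 4 : ℕ) : ℤ) ≤ σ.ko P := by exact_mod_cast Nat.div_le_self _ _
  have hkc4 : ((σ.kc P / 4 : ℕ) : ℤ) ≤ σ.kc P := by exact_mod_cast Nat.div_le_self _ _
  have hko4' : 4 * ((σ.ko P / 4 : ℕ) : ℤ) ≤ σ.ko P := by exact_mod_cast Nat.mul_div_le _ _
  have hkc4' : 4 * ((σ.kc P / 4 : ℕ) : ℤ) ≤ σ.kc P := by exact_mod_cast Nat.mul_div_le _ _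
  have h0ko4 : (0 : ℤ) ≤ (σ.ko P / 4 : ℕ) := Nat.cast_nonneg _
  have h0kc4 : (0 : ℤ) ≤ (σ.kc P / 4 : ℕ) := Nat.cast_nonneg _
  have hrB4 : 4 * ((P.rB / 4 : ℕ) : ℤ) ≤ P.rB ∧ (P.rB : ℤ) ≤ 4 * ((P.rB / 4 : ℕ) : ℤ) + 3 := by clear * - hs0; omega
  have hrB64 : 64 * ((P.rB / 64 : ℕ) : ℤ) ≤ P.rB ∧ (P.rB : ℤ) ≤ 64 * ((P.rB / 64 : ℕ) : ℤ) + 63 := by clear * - hs0; omega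
  have hrW4 : 4 * ((P.rW / 4 : ℕ) : ℤ) ≤ P.rW ∧ (P.rW : ℤ) ≤ 4 * ((P.rW / 4 : ℕ) : ℤ) + 3 := by clear * - hs0; omega
  have hrW64 : 64 * ((P.rW / 64 : ℕ) : ℤ) ≤ P.rW ∧ (P.rW : ℤ) ≤ 64 * ((P.rW / 64 : ℕ) : ℤ) + 63 := by clear * - hs0; omega
  have h2 : 2 ≤ σ.ιc P := by
    refine idx_le_of_mul_le (s := P.s) (c := (P.s : ℤ) - 1) hs0 ?_ (by linarith)
    simp only [Nat.cast_ofNat]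
    linarith only [hι2, hξc, ha4, hwc1, hkc1, hrB1, hR₀, hμ, hs, hk₀, hw1, hε1, hM]
  have h4 : σ.ιc P + 4 ≤ P.nB := by
    refine idx_le_of_mul_le (s := P.s) (c := 0) hs0 ?_ (by exact_mod_cast hs0)
    simp only [Nat.cast_add, Nat.cast_ofNat]
    linarith only [hι1, hξc, ha3, hwc2, hkc2, hkc4, hnB', hR₀, hμ, hs, hk₀, hw1, hε1]
  have hnB1 : 1 ≤ P.nB := by clear * - h4; omega
  have hwb := ewindow_pos_bounds (n := P.nB) (ι := σ.ιc P) hσ.hic (by clear * - h4; omega)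
  have hlo : σ.loB P = blockOff P.nB σ.ic + 2 * (σ.ιc P - 2) := rfl
  have hhi : σ.hiB P = σ.loB P + 7 := rfl
  refine ⟨h2, h4, hnB1, by rw [hlo]; exact Nat.le_add_right _ _, hhi, ?_, ?_⟩
  · rw [hhi, hlo]; clear * - hwb h2; omega
  · rw [hhi, hlo]; clear * - hwb h2; omega

/-- **The window of ring `W`** (positions `loW, …, hiW` on the side `3`, crossed by the black
approach tube) and the white exit run (side `0` of ring `W`). [folklore] -/
theorem windowW_factsE (hV : P.Valid) (hσ : σ.InRange P) (hadm : σ.AdmissibleE P) :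
    1 ≤ P.nW ∧ σ.loW P ≤ σ.hiW P ∧ σ.hiW P < 12 * P.nW - 4 ∧ blockOff P.nW 3 ≤ σ.loW P ∧ σ.hiW P < blockOff P.nW 4 ∧
      σ.xc P + P.dW < P.nW ∧ 2 * (σ.xc P + P.dW) < σ.loW P ∧
      -(P.rW : ℤ) + (σ.xc P : ℕ) * P.s - P.e ≤ σ.tgc P ∧
      σ.tgc P + (P.rW / 64 : ℕ) ≤ -(P.rW : ℤ) + ((σ.xc P : ℕ) + P.dW) * P.s - P.e := by
  obtain ⟨⟨hs, hk₀, hμ, hw1, hw2, he1, he2, hε1, hε2⟩, ⟨hrB1, hrB2, hrW1, hrW2, hnB, hnW⟩, -, ⟨hM, hR₀, hR₀M, hn, hN, hN'⟩,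
    -, ⟨-, -, -, -, ht1, ht2, ht3, ht4⟩, -⟩ := eifacts hV hσ hadm
  have hnW' : ((P.nW : ℕ) : ℤ) * P.s = P.rW := by exact_mod_cast hnW
  have hs0 : 0 < P.s := by clear * - hs hk₀; omega
  have hs1 : 1 ≤ P.s := hs0
  have hrB4 : 4 * ((P.rB / 4 : ℕ) : ℤ) ≤ P.rB ∧ (P.rB : ℤ) ≤ 4 * ((P.rB / 4 : ℕ) : ℤ) + 3 := by clear * - hs0; omega
  have hrB64 : 64 * ((P.rB / 64 : ℕ) : ℤ) ≤ P.rB ∧ (P.rB : ℤ) ≤ 64 * ((P.rB / 64 : ℕ) : ℤ) + 63 := by clear * - hs0; omega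
  have hrW4 : 4 * ((P.rW / 4 : ℕ) : ℤ) ≤ P.rW ∧ (P.rW : ℤ) ≤ 4 * ((P.rW / 4 : ℕ) : ℤ) + 3 := by clear * - hs0; omega
  have hrW64 : 64 * ((P.rW / 64 : ℕ) : ℤ) ≤ P.rW ∧ (P.rW : ℤ) ≤ 64 * ((P.rW / 64 : ℕ) : ℤ) + 63 := by clear * - hs0; omega
  -- the window laterals
  have hL1lo : -(P.rW : ℤ) ≤ σ.tgo P := by clear * - ht1 hrB2 hrW1 hs hμ; omega
  have hL2lo : -(P.rW : ℤ) ≤ σ.tgo P + (P.rB / 64 : ℕ) := by clear * - ht1 hrB2 hrW1 hs hμ; omega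
  have hL1 := latIdx_spec (r := P.rW) (s := P.s) hs1 hL1lo
  have hL2 := latIdx_spec (r := P.rW) (s := P.s) hs1 hL2lo
  have hmono : latIdx P.s P.rW (σ.tgo P) ≤ latIdx P.s P.rW (σ.tgo P + (P.rB / 64 : ℕ)) := latIdx_mono (by clear * -; omega)
  have hL2n : latIdx P.s P.rW (σ.tgo P + (P.rB / 64 : ℕ)) + 3 ≤ P.nW := by
    refine idx_le_of_mul_le (s := P.s) (c := 0) hs0 ?_ (by exact_mod_cast hs0)
    simp only [Nat.cast_add, Nat.cast_ofNat]
    linarith only [hL2.1, ht2, hnW', hrB1, hrB2, hrW1, hμ, hs, hk₀, hM, hrB4.2, hrB64.1]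
  -- the exit run
  have htclo : -(P.rW : ℤ) ≤ σ.tgc P := by clear * - ht3; omega
  have hX := latIdx_spec (r := P.rW) (s := P.s) hs1 htclo
  have hxc : σ.xc P = latIdx P.s P.rW (σ.tgc P) := rfl
  have hd : P.dW = P.rW / 64 / P.s + 3 := rfl
  have hds1 : ((P.rW / 64 / P.s : ℕ) : ℤ) * P.s ≤ (P.rW / 64 : ℕ) := by exact_mod_cast Nat.div_mul_le_self _ _
  have hds2 : ((P.rW / 64 : ℕ) : ℤ) < ((P.rW / 64 / P.s : ℕ) : ℤ) * P.s + P.s := by exact_mod_cast Nat.lt_div_mul_add hs0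
  have hxd : σ.xc P + P.dW < P.nW := by
    have : σ.xc P + P.dW + 1 ≤ P.nW := by
      refine idx_le_of_mul_le (s := P.s) (c := 0) hs0 ?_ (by exact_mod_cast hs0)
      rw [hxc, hd]; simp only [Nat.cast_add, Nat.cast_ofNat, Nat.cast_one]
      linarith only [hX.1, hds1, ht4, hnW', hrW1, hμ, hs, hk₀, hM, hrW4.2, hrW64.1]
    clear * - this; omega
  have hnW1 : 1 ≤ P.nW := by clear * - hxd; omega
  have hyLo : σ.yLo P = latIdx P.s P.rW (σ.tgo P) - 1 := rfl
  have hyHi : σ.yHi P = latIdx P.s P.rW (σ.tgo P + (P.rB / 64 : ℕ)) + 1 := rfl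
  have hloW : σ.loW P = blockOff P.nW 3 + 2 * σ.yLo P := rfl
  have hhiW : σ.hiW P = blockOff P.nW 3 + 2 * σ.yHi P + 1 := rfl
  refine ⟨hnW1, ?_, ?_, ?_, ?_, hxd, ?_, ?_, ?_⟩
  · rw [hloW, hhiW, hyLo, hyHi]; clear * - hmono; omega
  · rw [hhiW, hyHi]; simp only [blockOff]; clear * - hL2n hnW1; omega
  · rw [hloW]; exact Nat.le_add_right _ _
  · rw [hhiW, hyHi]; simp only [blockOff]; clear * - hL2n hnW1; omega
  · rw [hloW]; simp only [blockOff]; clear * - hxd hnW1; omega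
  · rw [hxc]; have h0 : (0 : ℤ) ≤ P.e := by positivity
    linarith only [hX.1, h0]
  · rw [hxc, hd]; simp only [Nat.cast_add, Nat.cast_ofNat]
    linarith only [hX.2, hds1, hds2, he1, hs, hk₀]

/-- **The entry piece of the open arm** lies in the block of its side and outside the window
(`SepOKE`). [folklore] -/
theorem gEo_factsE (hV : P.Valid) (hσ : σ.InRange P) (hadm : σ.AdmissibleE P) (hsep : σ.SepOKE P) :
    σ.ιo P < P.nB ∧ σ.gEo P < 12 * P.nB - 4 ∧ (σ.gEo P < σ.loB P ∨ σ.hiB P < σ.gEo P) := by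
  obtain ⟨⟨hs, hk₀, hμ, hw1, hw2, he1, he2, hε1, hε2⟩, ⟨hrB1, hrB2, hrW1, hrW2, hnB, hnW⟩, -, ⟨hM, hR₀, hR₀M, hn, hN, hN'⟩,
    ⟨hko1, hko2, hkc1, hkc2, hwo1, hwo2, hwc1, hwc2, hξo, hξc⟩, ⟨ha1, ha2, ha3, ha4, -, -, -, -⟩, ⟨ho1, ho2, hc1, hc2, -, -⟩⟩ :=
    eifacts hV hσ hadm
  obtain ⟨hι2, hι4, hnB1, hlo, hhi, hhi', hhi''⟩ := windowB_factsE hV hσ hadm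
  have hnB' : ((P.nB : ℕ) : ℤ) * P.s = P.rB := by exact_mod_cast hnB
  have hs0 : 0 < P.s := by clear * - hs hk₀; omega
  have hko4 : ((σ.ko P / 4 : ℕ) : ℤ) ≤ σ.ko P := by exact_mod_cast Nat.div_le_self _ _
  have hkc4 : ((σ.kc P / 4 : ℕ) : ℤ) ≤ σ.kc P := by exact_mod_cast Nat.div_le_self _ _
  have hko4' : 4 * ((σ.ko P / 4 : ℕ) : ℤ) ≤ σ.ko P := by exact_mod_cast Nat.mul_div_le _ _
  have hkc4' : 4 * ((σ.kc P / 4 : ℕ) : ℤ) ≤ σ.kc P := by exact_mod_cast Nat.mul_div_le _ _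
  have h0ko4 : (0 : ℤ) ≤ (σ.ko P / 4 : ℕ) := Nat.cast_nonneg _
  have h0kc4 : (0 : ℤ) ≤ (σ.kc P / 4 : ℕ) := Nat.cast_nonneg _
  have hrB4 : 4 * ((P.rB / 4 : ℕ) : ℤ) ≤ P.rB ∧ (P.rB : ℤ) ≤ 4 * ((P.rB / 4 : ℕ) : ℤ) + 3 := by clear * - hs0; omega
  have hrB64 : 64 * ((P.rB / 64 : ℕ) : ℤ) ≤ P.rB ∧ (P.rB : ℤ) ≤ 64 * ((P.rB / 64 : ℕ) : ℤ) + 63 := by clear * - hs0; omega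
  have hrW4 : 4 * ((P.rW / 4 : ℕ) : ℤ) ≤ P.rW ∧ (P.rW : ℤ) ≤ 4 * ((P.rW / 4 : ℕ) : ℤ) + 3 := by clear * - hs0; omega
  have hrW64 : 64 * ((P.rW / 64 : ℕ) : ℤ) ≤ P.rW ∧ (P.rW : ℤ) ≤ 64 * ((P.rW / 64 : ℕ) : ℤ) + 63 := by clear * - hs0; omega
  have hιon : σ.ιo P + 4 ≤ P.nB := by
    refine idx_le_of_mul_le (s := P.s) (c := 0) hs0 ?_ (by exact_mod_cast hs0)
    simp only [Nat.cast_add, Nat.cast_ofNat]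
    linarith only [ho1, hξo, ha1, hwo2, hko2, hko4, hnB', hR₀, hμ, hs, hk₀, hw1, hε1]
  have hιo : σ.ιo P < P.nB := by clear * - hιon; omega
  have hgEo : σ.gEo P = extPos P.nB σ.io (σ.ιo P) := rfl
  have hblock := extPos_mem_block hnB1 hσ.hio hιo
  refine ⟨hιo, by rw [hgEo]; exact extPos_lt hnB1 hσ.hio hιo, ?_⟩
  rw [hgEo]
  have hloB : σ.loB P = blockOff P.nB σ.ic + 2 * (σ.ιc P - 2) := rfl
  by_cases hii : σ.io = σ.ic
  · -- same side: the lateral indices are at least `7` apart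
    have hgap : σ.To P + 8 * σ.ko P < σ.Tc P + P.w ∨ σ.Tc P + 8 * σ.kc P < σ.To P + P.w := by
      rcases hsep with h | h | h
      · exact absurd hii h
      · exact Or.inl h
      · exact Or.inr h
    have hss : (P.s : ℤ) - 1 < P.s := sub_one_lt _
    unfold extPos
    rw [hii]
    rcases hgap with hgap | hgap
    · have h7 : σ.ιo P + 7 ≤ σ.ιc P := by
        refine idx_le_of_mul_le (s := P.s) (c := (P.s : ℤ) - 1) hs0 ?_ hss
        rw [Nat.cast_add, Nat.cast_ofNat]
        linarith only [ho1, hc2, hgap, hξo, hξc, hkc1, hko1, hs, hw1, hε1, hwo2, hwc1, hk₀, hko4', h0kc4]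
      left; rw [hloB]; clear * - h7 hι2; omega
    · have h7 : σ.ιc P + 7 ≤ σ.ιo P := by
        refine idx_le_of_mul_le (s := P.s) (c := (P.s : ℤ) - 1) hs0 ?_ hss
        rw [Nat.cast_add, Nat.cast_ofNat]
        linarith only [hc1, ho2, hgap, hξo, hξc, hkc1, hko1, hs, hw1, hε1, hwc2, hwo1, hk₀, hkc4', h0ko4]
      right; rw [hhi, hloB]; clear * - h7 hι2; omega
  · -- different sides: the blocks are disjoint
    rcases Nat.lt_or_gt_of_ne hii with hlt | hlt
    · left
      exact Nat.lt_of_lt_of_le hblock.2 ((blockEnd_le_blockOff hlt hσ.hic).trans hlo)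
    · right
      exact Nat.lt_of_lt_of_le hhi' ((blockEnd_le_blockOff hlt hσ.hio).trans hblock.1)

/-- **The entry piece of the closed arm** (colour-exchanged picture: side `ic'` of ring `W`) lies in
its block and outside the window of ring `W`. [folklore] -/
theorem gEc_factsE (hV : P.Valid) (hσ : σ.InRange P) (hadm : σ.AdmissibleE P) :
    σ.ιw P < P.nW ∧ σ.gEc P < 12 * P.nW - 4 ∧ (σ.gEc P < σ.loW P ∨ σ.hiW P < σ.gEc P) := by
  obtain ⟨⟨hs, hk₀, hμ, hw1, hw2, he1, he2, hε1, hε2⟩, ⟨hrB1, hrB2, hrW1, hrW2, hnB, hnW⟩, -, ⟨hM, hR₀, hR₀M, hn, hN, hN'⟩,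
    ⟨hko1, hko2, hkc1, hkc2, hwo1, hwo2, hwc1, hwc2, hξo, hξc⟩, ⟨ha1, ha2, ha3, ha4, ht1, ht2, -, -⟩, ⟨-, -, -, -, hw1', hw2'⟩⟩ :=
    eifacts hV hσ hadm
  obtain ⟨hnW1, hlohi, hhi, hlo3, hhi4, -, -, -, -⟩ := windowW_factsE hV hσ hadm
  have hnW' : ((P.nW : ℕ) : ℤ) * P.s = P.rW := by exact_mod_cast hnW
  have hs0 : 0 < P.s := by clear * - hs hk₀; omega
  have hs1 : 1 ≤ P.s := hs0
  have hss : (P.s : ℤ) - 1 < P.s := sub_one_lt _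
  have hic' : σ.ic' < 6 := Nat.mod_lt _ (by norm_num)
  have hko4 : ((σ.ko P / 4 : ℕ) : ℤ) ≤ σ.ko P := by exact_mod_cast Nat.div_le_self _ _
  have hkc4 : ((σ.kc P / 4 : ℕ) : ℤ) ≤ σ.kc P := by exact_mod_cast Nat.div_le_self _ _
  have hko4' : 4 * ((σ.ko P / 4 : ℕ) : ℤ) ≤ σ.ko P := by exact_mod_cast Nat.mul_div_le _ _
  have hkc4' : 4 * ((σ.kc P / 4 : ℕ) : ℤ) ≤ σ.kc P := by exact_mod_cast Nat.mul_div_le _ _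
  have h0ko4 : (0 : ℤ) ≤ (σ.ko P / 4 : ℕ) := Nat.cast_nonneg _
  have h0kc4 : (0 : ℤ) ≤ (σ.kc P / 4 : ℕ) := Nat.cast_nonneg _
  have hrB4 : 4 * ((P.rB / 4 : ℕ) : ℤ) ≤ P.rB ∧ (P.rB : ℤ) ≤ 4 * ((P.rB / 4 : ℕ) : ℤ) + 3 := by clear * - hs0; omega
  have hrB64 : 64 * ((P.rB / 64 : ℕ) : ℤ) ≤ P.rB ∧ (P.rB : ℤ) ≤ 64 * ((P.rB / 64 : ℕ) : ℤ) + 63 := by clear * - hs0; omega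
  have hrW4 : 4 * ((P.rW / 4 : ℕ) : ℤ) ≤ P.rW ∧ (P.rW : ℤ) ≤ 4 * ((P.rW / 4 : ℕ) : ℤ) + 3 := by clear * - hs0; omega
  have hrW64 : 64 * ((P.rW / 64 : ℕ) : ℤ) ≤ P.rW ∧ (P.rW : ℤ) ≤ 64 * ((P.rW / 64 : ℕ) : ℤ) + 63 := by clear * - hs0; omega
  have hιwn : σ.ιw P + 4 ≤ P.nW := by
    refine idx_le_of_mul_le (s := P.s) (c := 0) hs0 ?_ (by exact_mod_cast hs0)
    simp only [Nat.cast_add, Nat.cast_ofNat]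
    linarith only [hw1', hξc, ha3, hwc2, hkc2, hkc4, hnW', hR₀, hμ, hs, hk₀, hw1, hε1, hrB1, hrW1]
  have hιw : σ.ιw P < P.nW := by clear * - hιwn; omega
  have hgEc : σ.gEc P = extPos P.nW σ.ic' (σ.ιw P) := rfl
  have hblock := extPos_mem_block hnW1 hic' hιw
  refine ⟨hιw, by rw [hgEc]; exact extPos_lt hnW1 hic' hιw, ?_⟩
  rw [hgEc]
  -- the window laterals
  have hL1lo : -(P.rW : ℤ) ≤ σ.tgo P := by clear * - ht1 hrB2 hrW1 hs hμ; omega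
  have hL2lo : -(P.rW : ℤ) ≤ σ.tgo P + (P.rB / 64 : ℕ) := by clear * - ht1 hrB2 hrW1 hs hμ; omega
  have hL1 := latIdx_spec (r := P.rW) (s := P.s) hs1 hL1lo
  have hL2 := latIdx_spec (r := P.rW) (s := P.s) hs1 hL2lo
  have hyLo : σ.yLo P = latIdx P.s P.rW (σ.tgo P) - 1 := rfl
  have hyHi : σ.yHi P = latIdx P.s P.rW (σ.tgo P + (P.rB / 64 : ℕ)) + 1 := rfl
  have hloW : σ.loW P = blockOff P.nW 3 + 2 * σ.yLo P := rfl
  have hhiW : σ.hiW P = blockOff P.nW 3 + 2 * σ.yHi P + 1 := rfl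
  by_cases h3 : σ.ic' = 3
  · -- the closed tip sits on side `0`: the danger zone
    have hic0 : σ.ic = 0 := by have := hσ.hic; unfold ESlot.ic' at h3; clear * - this h3; omega
    have hgap := tgtRow_false_add_le (n := P.rB) (by clear * - hrB1 hμ hk₀; omega)
    rw [h3]
    unfold extPos
    rw [hloW, hhiW, hyLo, hyHi]
    have hDdef : σ.bo P = !decide (σ.ic = 0 ∧ P.Danger P.rB (σ.ξc P)) := rfl
    by_cases hD : P.Danger P.rB (σ.ξc P)
    · have hbo : σ.bo P = false := by rw [hDdef, hic0]; simp [hD]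
      have htgo' : σ.tgo P = tgtRow P.rB false := by show tgtRow P.rB (σ.bo P) = _; rw [hbo]
      unfold EParams.Danger at hD
      have : latIdx P.s P.rW (σ.tgo P + (P.rB / 64 : ℕ)) + 2 ≤ σ.ιw P := by
        refine idx_le_of_mul_le (s := P.s) (c := (P.s : ℤ) - 1) hs0 ?_ hss
        simp only [Nat.cast_add, Nat.cast_ofNat]
        linarith only [hL2.1, hw2', hD.1, htgo', hgap, hrB1, hμ, hs, hk₀, hε1, hM, hrB4.1, hrB4.2, hrB64.1, hrB64.2]
      right; clear * - this; omega
    · have hbo : σ.bo P = true := by rw [hDdef]; simp [hD]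
      have htgo' : σ.tgo P = tgtRow P.rB true := by show tgtRow P.rB (σ.bo P) = _; rw [hbo]
      unfold EParams.Danger at hD
      rcases lt_or_ge (σ.ξc P) (tgtRow P.rB true - (P.rB / 64 : ℕ) - P.μ - 8 * P.s) with hlt | hge
      · have : σ.ιw P + 2 ≤ latIdx P.s P.rW (σ.tgo P) := by
          refine idx_le_of_mul_le (s := P.s) (c := (P.s : ℤ) - 1) hs0 ?_ hss
          simp only [Nat.cast_add, Nat.cast_ofNat]
          linarith only [hw1', hL1.2, hlt, htgo', hμ, hs, hk₀]
        left; clear * - this; omega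
      · have hgt : tgtRow P.rB true + (P.rB / 64 : ℕ) + P.μ + 8 * P.s < σ.ξc P := by
          by_contra h; exact hD ⟨hge, not_lt.1 h⟩
        have : latIdx P.s P.rW (σ.tgo P + (P.rB / 64 : ℕ)) + 2 ≤ σ.ιw P := by
          refine idx_le_of_mul_le (s := P.s) (c := (P.s : ℤ) - 1) hs0 ?_ hss
          simp only [Nat.cast_add, Nat.cast_ofNat]
          linarith only [hL2.1, hw2', hgt, htgo', hμ, hs, hk₀, hε1]
        right; clear * - this; omega
  · -- another side: the blocks are disjoint
    rcases Nat.lt_or_gt_of_ne h3 with hlt | hlt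
    · left
      exact Nat.lt_of_lt_of_le hblock.2 ((blockEnd_le_blockOff hlt (by norm_num)).trans hlo3)
    · right
      have h4 : blockOff P.nW 4 ≤ blockOff P.nW σ.ic' := by
        rcases Nat.lt_or_ge 4 σ.ic' with h | h
        · exact (blockOff_le_blockEnd (by norm_num)).trans (blockEnd_le_blockOff h hic')
        · have : σ.ic' = 4 := by clear * - h hlt; omega
          rw [this]
      exact Nat.lt_of_lt_of_le hhi4 (h4.trans hblock.1)

end ESlot

end Literature.Probability.Percolation
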